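import Summits.ValiantsHypothesis.ValiantsHypothesis.Theorems.KPlusLogSqLawTropicalBSplitGlue
import Summits.ValiantsHypothesis.ValiantsHypothesis.Theorems.KPlusLogSqLawTropicalCensusRows

/-!
# Route `KPlusLogSqLaw`, crux `TropicalB` (stmt-ValiantsHypothesis-19771) — the FORCED-INCIDENCE LAW (design currency):
# the best term with one column's row FORCED agrees with the dominant term off the exchange cycle through that column

HONEST FRAMING.  Helper file (cell `pub-symmetroid`, seat val-sym-trop-p5 g27, refuter-adjacent lane, 2026-08-29; `--supports
stmt-ValiantsHypothesis-19771 --as helper`).  A STRUCTURE law valid for every dominance design `(d, v, ε)` at every format and every slope `θ`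
(no hypothesis on exponents, valuations, support or signs); it is the design-currency form of the pure-combinatorics single-cycle law
`ForcedCycle.sameCycle_of_forced` (p730261) and the structural core of the «frozen-parent law» of the seat's memo LEX-PRODUCT-g27.md §3
(evidence on 19771): PLACING A GIANT — forcing the row used in one column, equivalently deleting that row and column from the design — moves
the optimal term along ONE exchange cycle through the forced column, so the optima of a one-deletion sub-block while the parent block is
frozen form a parametric PATH family.  It bounds nothing for `TropicalB` in its window and bears on neither `WeakLifting`, DoorA26 / DoorA34,
`MatrixDescartes` (stmt-ValiantsHypothesis-18050) nor VP ≠ VNP.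

THE LAW.  Let `p` be dominant at `θ` (`IsDominant`: the unique optimum among present terms) and let `q` be a present term that is optimal
among the present terms using the same row as `q` in the column `i₀` (`q'.1 i₀ = q.1 i₀ → tropWeight q' ≤ tropWeight q`).  Then
* `agree_off_forced` — on every column set `C ∌ i₀` on which `p` and `q` use the same rows AS SETS (`C.image p.1 = C.image q.1`, i.e. a union
  of cycles of `p.1⁻¹ q.1` and of columns where the rows coincide), `q` AGREES with `p` (rows and classes);
* `agree_of_not_sameCycle` — in particular `q` and `p` differ (in row or class) only on columns in the cycle of `i₀` of `p.1⁻¹ * q.1`: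
  `¬ SameCycle (p.1⁻¹ * q.1) i₀ i → (q.1 i, q.2 i) = (p.1 i, p.2 i)`;
* `eq_of_forced_row_eq` — if the forced row is `p`'s own (`q.1 i₀ = p.1 i₀`) then `q = p`.
Proof: swap `p` and `q` on `C` (both hybrids are present terms; the one carrying `q` on `C` differs from `p`, the other still uses `q`'s row in
column `i₀`); the two hybrid weights add up to `tropWeight p + tropWeight q` column by column, while dominance of `p` and constrained
optimality of `q` make the sum strictly smaller.  [folklore: exchange argument; packaging this seat]
-/

set_option linter.dupNamespace false
set_option autoImplicit false

namespace Summit.ValiantsHypothesis.ValiantsHypothesis.Theorems.KPlusLogSqLaw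

open Summit.ValiantsHypothesis.ValiantsHypothesis.Theorems.MatrixDescartes.Negative
open Summit.ValiantsHypothesis.ValiantsHypothesis.Theorems.LacunarySymmetroidMatrixDescartes.TropicalCensus (tropWeight_eq_sum)
open scoped BigOperators
open Finset

namespace ForcedIncidence

variable {m K : ℕ}

/-- the swapped row map of two permutations agreeing as sets on `C` is injective. [folklore] -/
theorem swap_injective (a b : Equiv.Perm (Fin m)) (C : Finset (Fin m)) (hab : C.image a = C.image b) :
    Function.Injective (fun i => if i ∈ C then b i else a i) := by
  classical
  intro i j hij
  simp only at hij
  by_cases hi : i ∈ C <;> by_cases hj : j ∈ C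
  · rw [if_pos hi, if_pos hj] at hij; exact b.injective hij
  · rw [if_pos hi, if_neg hj] at hij
    have : b i ∈ C.image a := by rw [hab]; exact mem_image_of_mem _ hi
    obtain ⟨i', hi', hii'⟩ := mem_image.mp this
    rw [hij] at hii'
    have := a.injective hii'
    subst this
    exact absurd hi' hj
  · rw [if_neg hi, if_pos hj] at hij
    have : b j ∈ C.image a := by rw [hab]; exact mem_image_of_mem _ hj
    obtain ⟨j', hj', hjj'⟩ := mem_image.mp this
    rw [← hij] at hjj'
    have := a.injective hjj'
    subst this
    exact absurd hj' hi
  · rw [if_neg hi, if_neg hj] at hij; exact a.injective hij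

/-- **FORCED-INCIDENCE LAW (set form).**  `p` dominant at `θ`; `q` present and optimal among present terms using `q`'s row in column `i₀`;
`C ∌ i₀` a column set on which `p` and `q` use the same rows as sets.  Then `q` agrees with `p` on `C`. [folklore: exchange argument] -/
theorem agree_off_forced (d : Fin K → ℕ) (v ε : Fin m → Fin m → Fin K → ℤ) (θ : ℤ)
    {p q : Equiv.Perm (Fin m) × (Fin m → Fin K)} (hp : IsDominant d v ε θ p) (hq0 : termSign ε q ≠ 0) (i₀ : Fin m)
    (hq : ∀ q' : Equiv.Perm (Fin m) × (Fin m → Fin K), termSign ε q' ≠ 0 → q'.1 i₀ = q.1 i₀ →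
      tropWeight d v θ q' ≤ tropWeight d v θ q)
    (C : Finset (Fin m)) (hC : C.image p.1 = C.image q.1) (hi₀ : i₀ ∉ C) :
    ∀ i ∈ C, (q.1 i, q.2 i) = (p.1 i, p.2 i) := by
  classical
  by_contra hcon
  push Not at hcon
  obtain ⟨i₁, hi₁C, hi₁⟩ := hcon
  -- the two hybrids: `h₁ = (q on C, p off C)`, `h₂ = (p on C, q off C)`
  set π₁ : Equiv.Perm (Fin m) := Equiv.ofBijective _
    (Finite.injective_iff_bijective.mp (swap_injective p.1 q.1 C hC)) with hπ₁
  set π₂ : Equiv.Perm (Fin m) := Equiv.ofBijective _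
    (Finite.injective_iff_bijective.mp (swap_injective q.1 p.1 C hC.symm)) with hπ₂
  set h₁ : Equiv.Perm (Fin m) × (Fin m → Fin K) := (π₁, fun i => if i ∈ C then q.2 i else p.2 i) with hh₁
  set h₂ : Equiv.Perm (Fin m) × (Fin m → Fin K) := (π₂, fun i => if i ∈ C then p.2 i else q.2 i) with hh₂
  have h11 : ∀ i, h₁.1 i = if i ∈ C then q.1 i else p.1 i := fun i => rfl
  have h21 : ∀ i, h₂.1 i = if i ∈ C then p.1 i else q.1 i := fun i => rfl
  have h12 : ∀ i, h₁.2 i = if i ∈ C then q.2 i else p.2 i := fun i => rfl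
  have h22 : ∀ i, h₂.2 i = if i ∈ C then p.2 i else q.2 i := fun i => rfl
  -- both hybrids are present
  have hp0 := (termSign_ne_zero_iff ε p).mp hp.1
  have hq0' := (termSign_ne_zero_iff ε q).mp hq0
  have hh₁0 : termSign ε h₁ ≠ 0 := by
    rw [termSign_ne_zero_iff]
    intro i
    rw [h11, h12]
    by_cases hi : i ∈ C
    · rw [if_pos hi, if_pos hi]; exact hq0' i
    · rw [if_neg hi, if_neg hi]; exact hp0 i
  have hh₂0 : termSign ε h₂ ≠ 0 := by
    rw [termSign_ne_zero_iff]
    intro i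
    rw [h21, h22]
    by_cases hi : i ∈ C
    · rw [if_pos hi, if_pos hi]; exact hp0 i
    · rw [if_neg hi, if_neg hi]; exact hq0' i
  -- `h₁ ≠ p` (they differ in column `i₁ ∈ C`)
  have hne : h₁ ≠ p := by
    intro h
    apply hi₁
    have e1 : h₁.1 i₁ = p.1 i₁ := by rw [h]
    have e2 : h₁.2 i₁ = p.2 i₁ := by rw [h]
    rw [h11, if_pos hi₁C] at e1
    rw [h12, if_pos hi₁C] at e2
    rw [e1, e2]
  -- `h₂` uses `q`'s row in column `i₀`
  have hrow : h₂.1 i₀ = q.1 i₀ := by rw [h21, if_neg hi₀]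
  have w1 : tropWeight d v θ h₁ < tropWeight d v θ p := hp.2 h₁ hne hh₁0
  have w2 : tropWeight d v θ h₂ ≤ tropWeight d v θ q := hq h₂ hh₂0 hrow
  -- the weights add up columnwise
  have wsum : tropWeight d v θ h₁ + tropWeight d v θ h₂ = tropWeight d v θ p + tropWeight d v θ q := by
    rw [tropWeight_eq_sum, tropWeight_eq_sum, tropWeight_eq_sum, tropWeight_eq_sum, ← sum_add_distrib, ← sum_add_distrib]
    refine sum_congr rfl fun i _ => ?_
    rw [h11, h12, h21, h22]
    by_cases hi : i ∈ C
    · simp only [if_pos hi]; ring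
    · simp only [if_neg hi]
  linarith

/-- cycles: the columns off the cycle of `i₀` of `ρ = p.1⁻¹ q.1` form a set on which `p` and `q` use the same rows. [folklore] -/
theorem image_eq_of_not_sameCycle (p1 q1 : Equiv.Perm (Fin m)) (i₀ : Fin m) :
    ((univ : Finset (Fin m)).filter fun i => ¬ (p1⁻¹ * q1).SameCycle i₀ i).image p1 =
      ((univ : Finset (Fin m)).filter fun i => ¬ (p1⁻¹ * q1).SameCycle i₀ i).image q1 := by
  classical
  set ρ : Equiv.Perm (Fin m) := p1⁻¹ * q1 with hρ
  have hq1 : ∀ i, q1 i = p1 (ρ i) := fun i => by simp [hρ]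
  have hclosed : ∀ i, ¬ ρ.SameCycle i₀ i ↔ ¬ ρ.SameCycle i₀ (ρ i) := fun i => by
    rw [Equiv.Perm.sameCycle_apply_right]
  ext x
  simp only [mem_image, mem_filter, mem_univ, true_and]
  constructor
  · rintro ⟨i, hi, rfl⟩
    -- `p1 i = q1 (ρ⁻¹ i)` and `ρ⁻¹ i` is off the cycle
    refine ⟨ρ⁻¹ i, ?_, ?_⟩
    · intro h
      apply hi
      have := (Equiv.Perm.sameCycle_apply_right (f := ρ) (x := i₀) (y := ρ⁻¹ i)).mpr h
      simpa using this
    · rw [hq1]; simp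
  · rintro ⟨i, hi, rfl⟩
    exact ⟨ρ i, (hclosed i).mp hi, (hq1 i).symm⟩

/-- **FORCED-INCIDENCE LAW (cycle form).**  `p` dominant at `θ`, `q` present and optimal among present terms using `q`'s row in column
`i₀`: `q` and `p` differ (in row or class) only on the cycle of `i₀` of `p.1⁻¹ * q.1`. [folklore: exchange argument] -/
theorem agree_of_not_sameCycle (d : Fin K → ℕ) (v ε : Fin m → Fin m → Fin K → ℤ) (θ : ℤ)
    {p q : Equiv.Perm (Fin m) × (Fin m → Fin K)} (hp : IsDominant d v ε θ p) (hq0 : termSign ε q ≠ 0) (i₀ : Fin m)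
    (hq : ∀ q' : Equiv.Perm (Fin m) × (Fin m → Fin K), termSign ε q' ≠ 0 → q'.1 i₀ = q.1 i₀ →
      tropWeight d v θ q' ≤ tropWeight d v θ q)
    (i : Fin m) (hi : ¬ (p.1⁻¹ * q.1).SameCycle i₀ i) : (q.1 i, q.2 i) = (p.1 i, p.2 i) := by
  classical
  refine agree_off_forced d v ε θ hp hq0 i₀ hq
    ((univ : Finset (Fin m)).filter fun j => ¬ (p.1⁻¹ * q.1).SameCycle i₀ j)
    (image_eq_of_not_sameCycle p.1 q.1 i₀) ?_ i ?_
  · simp [Equiv.Perm.SameCycle.refl]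
  · simpa using hi

/-- **if the forced row is the dominant term's own, the constrained optimum IS the dominant term.** [folklore] -/
theorem eq_of_forced_row_eq (d : Fin K → ℕ) (v ε : Fin m → Fin m → Fin K → ℤ) (θ : ℤ)
    {p q : Equiv.Perm (Fin m) × (Fin m → Fin K)} (hp : IsDominant d v ε θ p) (hq0 : termSign ε q ≠ 0) (i₀ : Fin m)
    (hq : ∀ q' : Equiv.Perm (Fin m) × (Fin m → Fin K), termSign ε q' ≠ 0 → q'.1 i₀ = q.1 i₀ →
      tropWeight d v θ q' ≤ tropWeight d v θ q)
    (hrow : q.1 i₀ = p.1 i₀) : q = p := by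
  by_contra hne
  have w1 : tropWeight d v θ q < tropWeight d v θ p := hp.2 q hne hq0
  have w2 : tropWeight d v θ p ≤ tropWeight d v θ q := hq p hp.1 hrow.symm
  linarith

end ForcedIncidence

end Summit.ValiantsHypothesis.ValiantsHypothesis.Theorems.KPlusLogSqLaw
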